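import Mathlib.Analysis.Matrix.Order
import Mathlib.Analysis.CStarAlgebra.Matrix
import Mathlib.Analysis.Matrix.Spectrum
import HarnessLib

/-!
# Two trace inequalities for positive semidefinite complex matrices

* `re_trace_mul_nonneg_of_posSemidef`: `0 ≤ Re Tr(A B)` for `A, B ⪰ 0`
  (`Tr(A B) = Tr(C B Cᴴ) ≥ 0` with `A = Cᴴ C`);
* `re_trace_mul_self_le_sq_of_posSemidef` ("purity is at most one"):
  `Re Tr(A²) ≤ (Re Tr A)²` for `A ⪰ 0` (`Σ λᵢ² ≤ (Σ λᵢ)²` for the nonnegative eigenvalues);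
* the consequence `re_trace_sub_mul_sub_le_of_posSemidef`: for `A, B ⪰ 0` of real traces
  `a, b`, `Re Tr((A − B)²) ≤ a² + b²` (used with density matrices: `Tr(δ²) ≤ 2` for the
  difference `δ` of two states, Kempe–Regev–Unger–de Wolf 2008, §3.1.1).

These are standard facts of matrix analysis (e.g. R. Bhatia, *Matrix Analysis*, Springer GTM
169, 1997, §I and Exercise I.2 / §V); Mathlib has `Matrix.PosSemidef.trace_nonneg`,
`Matrix.IsHermitian.spectral_theorem`, `CStarAlgebra.nonneg_iff_eq_star_mul_self`, but neither
inequality (`lean search 'trace_mul.*PosSemidef|purity'`).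
-/

open Matrix
open scoped ComplexOrder MatrixOrder

namespace Literature.LinearAlgebra.Matrix

variable {n : Type*} [Fintype n] [DecidableEq n]

/-- For positive semidefinite `A, B`, `Re Tr(A B) ≥ 0`: writing `A = Cᴴ C`,
`Tr(A B) = Tr(C B Cᴴ)` is the trace of a positive semidefinite matrix. [folklore] -/
theorem re_trace_mul_nonneg_of_posSemidef {A B : Matrix n n ℂ} (hA : A.PosSemidef)
    (hB : B.PosSemidef) : 0 ≤ (A * B).trace.re := by
  obtain ⟨C, rfl⟩ := CStarAlgebra.nonneg_iff_eq_star_mul_self.mp hA.nonneg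
  rw [Matrix.mul_assoc, trace_mul_comm, Matrix.mul_assoc]
  have h : (C * (B * star C)).PosSemidef := by
    rw [← Matrix.mul_assoc, star_eq_conjTranspose]
    exact hB.mul_mul_conjTranspose_same C
  exact (Complex.nonneg_iff.1 h.trace_nonneg).1

omit [DecidableEq n] in
/-- The trace of a positive semidefinite complex matrix is real. [folklore] -/
theorem trace_im_of_posSemidef {A : Matrix n n ℂ} (hA : A.PosSemidef) : A.trace.im = 0 :=
  ((Complex.nonneg_iff.1 hA.trace_nonneg).2).symm

/-- **Purity bound**: for positive semidefinite `A`, `Re Tr(A²) ≤ (Re Tr A)²`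
(`Σ λᵢ² ≤ (Σ λᵢ)²` for the nonnegative eigenvalues, via the spectral theorem). [folklore] -/
theorem re_trace_mul_self_le_sq_of_posSemidef {A : Matrix n n ℂ} (hA : A.PosSemidef) :
    (A * A).trace.re ≤ A.trace.re ^ 2 := by
  have hH := hA.1
  set U := hH.eigenvectorUnitary with hU
  set D : Matrix n n ℂ := diagonal (RCLike.ofReal ∘ hH.eigenvalues) with hD
  have hAeq : A = (U : Matrix n n ℂ) * D * (star U : Matrix n n ℂ) := by
    have h := hH.spectral_theorem
    rwa [Unitary.conjStarAlgAut_apply] at h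
  have hUU : (star U : Matrix n n ℂ) * (U : Matrix n n ℂ) = 1 := Unitary.coe_star_mul_self U
  have h1 : (A * A).trace = ∑ i, ((hH.eigenvalues i : ℝ) : ℂ) ^ 2 := by
    have : A * A = (U : Matrix n n ℂ) * (D * D) * (star U : Matrix n n ℂ) := by
      conv_lhs => rw [hAeq]
      simp only [Matrix.mul_assoc]
      rw [← Matrix.mul_assoc (star U : Matrix n n ℂ) (U : Matrix n n ℂ), hUU, Matrix.one_mul]
    rw [this, trace_mul_cycle, hUU, Matrix.one_mul, hD, diagonal_mul_diagonal, trace_diagonal]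
    refine Finset.sum_congr rfl fun i _ => ?_
    simp [sq]
  have h2 : A.trace = ∑ i, ((hH.eigenvalues i : ℝ) : ℂ) := by
    rw [hH.trace_eq_sum_eigenvalues]; rfl
  rw [h1, h2, Complex.re_sum, Complex.re_sum]
  simp only [← Complex.ofReal_pow, Complex.ofReal_re]
  exact Finset.sum_sq_le_sq_sum_of_nonneg fun i _ => hA.eigenvalues_nonneg i

/-- For positive semidefinite `A, B`: `Re Tr((A − B)²) ≤ (Re Tr A)² + (Re Tr B)²`
(expand and drop the cross term `2 Re Tr(A B) ≥ 0`). With density matrices this is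
`Tr(δ²) ≤ 2` for `δ = ρ − τ`. [cite: KempeEtAl2010, §3.1.1 (base case)] -/
theorem re_trace_sub_mul_sub_le_of_posSemidef {A B : Matrix n n ℂ} (hA : A.PosSemidef)
    (hB : B.PosSemidef) :
    ((A - B) * (A - B)).trace.re ≤ A.trace.re ^ 2 + B.trace.re ^ 2 := by
  have h1 := re_trace_mul_self_le_sq_of_posSemidef hA
  have h2 := re_trace_mul_self_le_sq_of_posSemidef hB
  have h3 := re_trace_mul_nonneg_of_posSemidef hA hB
  have h4 : (B * A).trace = (A * B).trace := trace_mul_comm B A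
  have : ((A - B) * (A - B)).trace = (A * A).trace + (B * B).trace - 2 * (A * B).trace := by
    simp only [Matrix.sub_mul, Matrix.mul_sub, trace_sub, h4]; ring
  rw [this]
  simp only [Complex.sub_re, Complex.add_re, Complex.mul_re, Complex.re_ofNat, Complex.im_ofNat,
    zero_mul, sub_zero]
  linarith

end Literature.LinearAlgebra.Matrix
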